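import Summits.CriticalPhenomena.PercolationContinuityZ3.Theorems.Transplant.SkelPhiRootRun
import Summits.CriticalPhenomena.PercolationContinuityZ3.Theorems.Transplant.SkelPhiConcExcess
import Summits.CriticalPhenomena.PercolationContinuityZ3.Theorems.Transplant.SkelConcRootKits
import HarnessLib

/-!
# D″ node, (R) layer, file 5 (R-RECUT-PLAN §1 row 4): plumbing of the root band run at φ-LEVEL — the regions of `RootRun2.rootSched` read
# through `Skelφ.planarWindowWin hlip w₀ Rt` inside the cut root world `Skelφ.rootUS` and off the wired root cube, the root law `W0sub rootUS`
# a subbox weighting of the window graph on them and `0` off `G.edgeSet`, the planar diameter of the fresh root world, and the RIM EXCESS of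
# the root run (`Skelφ.real_rim_le_rootSG`, from hp-8 g29's `Skelφ.real_rim_le_of_radius`) — the φ-level successor of p2-g4's
# `SkelConcRootKits` §2–§3 (its §1 planar rooms are superseded by the schedule's `route` property, p1-g9's `WinChainData.roomS`)

builds on p205010 (kernel theorem, internal audit signed; external expert review pending) — nothing in this file uses p205010.
Status sentence (coordinator 2026-08-20T04:30Z): "θ(p_c) = 0 on ℤ^d, all d ≥ 2 — kernel-verified (Lean 4/Mathlib, standard axioms); internal
adversarial audit SIGNED 2026-08-20 04:29Z; external expert review pending."
Lane `prim-bschramm-*`, seat `prim-bschramm-p2` (gen 8; (R) = p2 lineage under D″); helper file (`--supports stmt-CriticalPhenomena-4575`).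

DICTIONARY (addendum K): `Φ ↦ (G, φ)`, `hlip` (planar window), `hstep` (step device: region windows into the spans of record, root into its
cube), `C : PCells ↦ P : PCells2`, `rootWAD … ↦ (rootSched P du h, rootWCD …)`, `Skel.real_rim_le_of_radius Φ ↦ Skelφ.real_rim_le_of_radius`;
Φ-free facts (`Skel.isSubbox_W0sub_win`, `Skel.W0sub_eq_zero_of_not_mem_edgeSet`, `KSchA.W0sub_apply_of_mem`) are IMPORTED (K2.5).
* §1 **`Skelφ.rootUS G φ P w₀ Λ q δc Rt du`** (the cut root world `(Q_0 ∪ E_{0,du}) ∩ B_G(w₀, Rt)`), `rootSched_stepD_subset_rootUS (hstep)`,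
  `rootSched_stepD_disjoint_Q`, **`isSubbox_rootSched (hstep)`**, `Q_subset_rootUS`, `RootRun2.abs_apply_le_of_mem_root_region₂`,
  `φ_sub_φ_mem_box_of_mem_rootUS` (planar diameter `60 rmax`);
* §2 **`Skelφ.real_rim_le_rootSG (hlip hstep)`** — under the cut root law, `P(⋃_{z ∈ Rim_k} w₀ ↔ z) ≤ η` for every step `k ≤ N`, given an
  excess radius `R₁ ≤ Rt − L'` at the running parameter for entrances at depth `E₀ + 1` (`rQ 0 0 ≤ E₀`) and habitats of planar diameter
  `60 rmax ≤ m`.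
[cite: KozmaNitzan2024, §4 p. 27 (G₀), p. 28 ((32) at the root), Lemma 10 (p. 17), Lemma 12 (p. 24)]
-/

noncomputable section

open MeasureTheory ProbabilityTheory
open scoped ENNReal Classical

namespace Summit.CriticalPhenomena.PercolationContinuityZ3.Theorems

namespace Transplant

namespace RootRun2

open Literature.Probability.Percolation Literature.Probability.LatticeModels
open Literature.Probability.Percolation.KozmaNitzan
open Literature.Probability.Percolation.KozmaNitzan.Cells (oth oth_ne eq_oth_of_ne sgOf sgOf_sign stepVec_apply_fst stepVec_apply_oth)

/-- A point of `BtwN 0 du ∪ Q (0 + du)` has coordinates of size `≤ 30 rmax` (`⊆ Cell 0 ∪ Cell (0 + du)`). [folklore] -/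
theorem abs_apply_le_of_mem_root_region₂ (P : PCells2) (du : MDir) {x : Site 2} (hx : x ∈ P.BtwN 0 du ∪ P.Q ((0 : Site 2) + stepVec du))
    (i : Fin 2) : |x i| ≤ 30 * (P.rmax : ℤ) := by
  have hx' : x ∈ P.Cell 0 ∪ P.Cell ((0 : Site 2) + stepVec du) := by
    rcases Finset.mem_union.1 hx with h' | h'
    · exact P.BtwN_subset_Cells 0 du h'
    · exact Finset.mem_union_right _ (P.Q_subset_Cell _ h')
  have hri : (P.r i : ℤ) ≤ P.rmax := by exact_mod_cast P.r_le_rmax i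
  have hr0 : (0 : ℤ) ≤ P.r i := by positivity
  rcases Finset.mem_union.1 hx' with h' | h'
  · rw [PCells2.Cell, PCells2.mem_abox_iff] at h'
    have := h' i
    simp only [PCells2.cen_zero, Pi.zero_apply] at this
    push_cast at this
    rw [abs_le]; constructor <;> nlinarith [this.1, this.2]
  · rw [PCells2.Cell, PCells2.mem_abox_iff] at h'
    have := h' i
    rw [cen_stepVec] at this
    push_cast at this
    have hsv : |(if i = du.1 then 20 * (P.r du.1 : ℤ) * sgOf du else 0)| ≤ 20 * (P.r i : ℤ) := by
      split_ifs with hi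
      · subst hi
        have h20 : (0 : ℤ) ≤ 20 * (P.r du.1 : ℤ) := by positivity
        have hσ1 : |sgOf du| = 1 := by rcases sgOf_sign du with hs | hs <;> simp [hs]
        rw [abs_mul, hσ1, mul_one, abs_of_nonneg h20]
      · rw [abs_zero]; positivity
    rw [abs_le] at hsv ⊢
    constructor <;> nlinarith [hsv.1, hsv.2, this.1, this.2]

end RootRun2

namespace Skelφ

open Literature.Probability.Percolation Literature.Probability.LatticeModels SimpleGraph GadgetSystem ProbeHistory HSiteScheme Contour KNCells
open Literature.Probability.Percolation.KozmaNitzan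
open Literature.Probability.Percolation.KozmaNitzan.Cells (sgOf sgOf_sign)
open KNCells.KSchA KNLevels ChainPlanar
open Literature.Barriers.CriticalPhenomena (graphBall mem_graphBall_self graphBall_mono)
open BoxProdZ2 (ConcRadiiG rootCtr)
open Skel (winGraph excess isSubbox_W0sub_win W0sub_eq_zero_of_not_mem_edgeSet)
open RootRun2 (RootBandOK rootSched rootSched_region_subset rootSched_region_disjoint_Q abs_apply_le_of_mem_root_region₂)

variable {V : Type} [DecidableEq V] (G : SimpleGraph V) [G.LocallyFinite] (φ : V → Site 2)

/-! ## §1 The cut root world and the regions of the root band run -/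

/-- **The cut root world** of direction `du` for the two-unit scheme of record: `(Q_0 ∪ E_{0,du}) ∩ B_G(w₀, Rt)` (regions of record: spans).
[cite: KozmaNitzan2024, §4 p. 28 ((32) at the root)] -/
def rootUS (P : PCells2) (w₀ : V) (Λ : ConcRadiiG) (q : unitInterval) (δc : ℝ) (Rt : ℕ) (du : MDir) : Finset V :=
  ((⟨cellGeomSG G φ P w₀ Λ, q, δc⟩ : KSchA V ℕ).U0root du).filter fun y => y ∈ graphBall G w₀ Rt

variable {G φ}

section Root

variable {P : PCells2} {w₀ : V} {Λ : ConcRadiiG} {q : unitInterval} {δc : ℝ} {Rt : ℕ} {du : MDir}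
  {s₁ R' ℓ₀ N WM : ℕ} {Wb : ℕ → ℕ} {ca cb q' ρ : ℤ}

/-- Membership in the cut root world. [folklore] -/
theorem mem_rootUS_iff {y : V} : y ∈ rootUS G φ P w₀ Λ q δc Rt du ↔
    y ∈ (⟨cellGeomSG G φ P w₀ Λ, q, δc⟩ : KSchA V ℕ).U0root du ∧ y ∈ graphBall G w₀ Rt :=
  Finset.mem_filter

/-- **Every region of the root band run lies in the cut root world** (radius facts with one unit of slack: the step device puts a window
vertex over `BtwN` / `Q_{0+du}` into the span). [cite: KozmaNitzan2024, §4 p. 28] -/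
theorem rootSched_stepD_subset_rootUS (hlip : Lip G φ) (hstep : Steps G φ) (h : RootBandOK P du s₁ R' ℓ₀ N WM Wb ca cb q' ρ)
    (hRB : Rt + 1 ≤ Λ.rB 0 0 du) (hRQ : Rt + 1 ≤ Λ.rQ 0 ((0 : Site 2) + stepVec du)) {k : ℕ} (hk : k ≤ N) :
    (planarWindowWin hlip w₀ Rt).stepD (rootSched P du h) k ⊆ rootUS G φ P w₀ Λ q δc Rt du := by
  intro v hv
  rw [PlanarWindow.stepD, planarWindowWin_W, mem_Win] at hv
  obtain ⟨hd, hφv⟩ := hv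
  refine Finset.mem_filter.2 ⟨?_, hd⟩
  rcases Finset.mem_union.1 (rootSched_region_subset h hk hφv) with hB | hQ
  · refine Finset.mem_union_right _ (Finset.mem_union_left _ ?_)
    change v ∈ VWin G φ w₀ (P.BtwN 0 du) (Λ.rB 0 0 du)
    exact mem_VWin_of_zdAdj hstep hd hRB hB (P.exists_adj_of_mem_BtwN 0 du hB)
  · refine Finset.mem_union_right _ (Finset.mem_union_right _ ?_)
    change v ∈ VWin G φ w₀ (P.Q ((0 : Site 2) + stepVec du)) (Λ.rQ 0 ((0 : Site 2) + stepVec du))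
    exact mem_VWin_of_zdAdj hstep hd hRQ hQ (P.exists_adj_of_mem_Q _ hQ)

/-- **Every region of the root band run is off the wired root cube** (planar footprints). [cite: KozmaNitzan2024, §4 p. 28] -/
theorem rootSched_stepD_disjoint_Q (hlip : Lip G φ) (h : RootBandOK P du s₁ R' ℓ₀ N WM Wb ca cb q' ρ) {k : ℕ} (hk : k ≤ N) :
    Disjoint ((planarWindowWin hlip w₀ Rt).stepD (rootSched P du h) k)
      ((⟨cellGeomSG G φ P w₀ Λ, q, δc⟩ : KSchA V ℕ).Γ.Q (⟨cellGeomSG G φ P w₀ Λ, q, δc⟩ : KSchA V ℕ).Γ.a₀ 0) := by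
  change Disjoint (Win G φ w₀ ((rootSched P du h).region k) Rt) (VWin G φ w₀ (P.Q 0) (Λ.rQ 0 0))
  exact Finset.disjoint_left.2 fun a ha hb =>
    Finset.disjoint_left.1 (rootSched_region_disjoint_Q h hk) ((mem_Win G φ).1 ha).2 (φ_mem_of_mem_VWin hb)

/-- **The root law cut to the ball is a subbox weighting of the window graph on every region of the root band run.**
[cite: KozmaNitzan2024, §4 p. 17 (subbox), p. 28] -/
theorem isSubbox_rootSched (hlip : Lip G φ) (hstep : Steps G φ) (h : RootBandOK P du s₁ R' ℓ₀ N WM Wb ca cb q' ρ)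
    (hRB : Rt + 1 ≤ Λ.rB 0 0 du) (hRQ : Rt + 1 ≤ Λ.rQ 0 ((0 : Site 2) + stepVec du)) {k : ℕ} (hk : k ≤ N) :
    IsSubbox (winGraph G w₀ Rt) ((⟨cellGeomSG G φ P w₀ Λ, q, δc⟩ : KSchA V ℕ).W0sub G (rootUS G φ P w₀ Λ q δc Rt du)) q
      ((planarWindowWin hlip w₀ Rt).stepD (rootSched P du h) k) :=
  isSubbox_W0sub_win G w₀ Rt (S := (⟨cellGeomSG G φ P w₀ Λ, q, δc⟩ : KSchA V ℕ)) (U := (⟨cellGeomSG G φ P w₀ Λ, q, δc⟩ : KSchA V ℕ).U0root du)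
    (rootSched_stepD_subset_rootUS hlip hstep h hRB hRQ hk) (rootSched_stepD_disjoint_Q hlip h hk)

/-- **The wired root cube lies in the cut root world** once `rQ 0 0 ≤ Rt`. [folklore] -/
theorem Q_subset_rootUS (hQR : Λ.rQ 0 0 ≤ Rt) :
    (⟨cellGeomSG G φ P w₀ Λ, q, δc⟩ : KSchA V ℕ).Γ.Q (⟨cellGeomSG G φ P w₀ Λ, q, δc⟩ : KSchA V ℕ).Γ.a₀ 0 ⊆ rootUS G φ P w₀ Λ q δc Rt du := by
  intro z hz
  refine Finset.mem_filter.2 ⟨Finset.mem_union_left _ hz, ?_⟩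
  change z ∈ VWin G φ w₀ (P.Q 0) (Λ.rQ 0 0) at hz
  exact graphBall_mono G w₀ hQR (mem_graphBall_of_mem_VWin hz)

/-- **The root-cube window of depth `R₀ ≤ min (rQ 0 0) Rt` lies in the cut root world** (the first hop's wired walk and seed, file 4).
[folklore] -/
theorem Win_Q_subset_rootUS (hstep : Steps G φ) {R₀ : ℕ} (hR₀Q : R₀ + 1 ≤ Λ.rQ 0 0) (hR₀t : R₀ ≤ Rt) :
    Win G φ w₀ (P.Q 0) R₀ ⊆ rootUS G φ P w₀ Λ q δc Rt du := by
  intro z hz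
  obtain ⟨hd, hφz⟩ := (mem_Win G φ).1 hz
  refine Finset.mem_filter.2 ⟨Finset.mem_union_left _ ?_, graphBall_mono G w₀ hR₀t hd⟩
  change z ∈ VWin G φ w₀ (P.Q 0) (Λ.rQ 0 0)
  exact mem_VWin_of_zdAdj hstep hd hR₀Q hφz (P.exists_adj_of_mem_Q _ hφz)

/-- **The fresh root world has planar diameter `≤ 60 rmax`**: two vertices of `rootUS ∖ Q_0` have footprints in `BtwN 0 du ∪ Q (0 + du)`.
[folklore] -/
theorem φ_sub_φ_mem_box_of_mem_rootUS {m : ℕ} (hm : 60 * P.rmax ≤ m) {d d' : V}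
    (hd : d ∈ rootUS G φ P w₀ Λ q δc Rt du \ (⟨cellGeomSG G φ P w₀ Λ, q, δc⟩ : KSchA V ℕ).Γ.Q (⟨cellGeomSG G φ P w₀ Λ, q, δc⟩ : KSchA V ℕ).Γ.a₀ 0)
    (hd' : d' ∈ rootUS G φ P w₀ Λ q δc Rt du \ (⟨cellGeomSG G φ P w₀ Λ, q, δc⟩ : KSchA V ℕ).Γ.Q (⟨cellGeomSG G φ P w₀ Λ, q, δc⟩ : KSchA V ℕ).Γ.a₀ 0) :
    φ d - φ d' ∈ box 2 m := by
  -- footprints of the fresh root world lie in `BtwN 0 du ∪ Q (0 + du)`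
  have key : ∀ {y : V}, y ∈ rootUS G φ P w₀ Λ q δc Rt du \
      (⟨cellGeomSG G φ P w₀ Λ, q, δc⟩ : KSchA V ℕ).Γ.Q (⟨cellGeomSG G φ P w₀ Λ, q, δc⟩ : KSchA V ℕ).Γ.a₀ 0 →
      φ y ∈ P.BtwN 0 du ∪ P.Q ((0 : Site 2) + stepVec du) := by
    intro y hy
    obtain ⟨hyU, hyQ⟩ := Finset.mem_sdiff.1 hy
    obtain ⟨hyU0, -⟩ := Finset.mem_filter.1 hyU
    rcases Finset.mem_union.1 hyU0 with hyQ' | hyE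
    · exact absurd hyQ' hyQ
    · change y ∈ VWin G φ w₀ (P.BtwN 0 du) (Λ.rB 0 0 du) ∪ VWin G φ w₀ (P.Q ((0 : Site 2) + stepVec du)) (Λ.rQ 0 ((0 : Site 2) + stepVec du))
        at hyE
      rcases Finset.mem_union.1 hyE with hyB | hyQ2
      · exact Finset.mem_union_left _ (φ_mem_of_mem_VWin hyB)
      · exact Finset.mem_union_right _ (φ_mem_of_mem_VWin hyQ2)
  have hm' : (60 : ℤ) * P.rmax ≤ m := by exact_mod_cast hm
  rw [mem_box]
  intro i
  have h1 := abs_apply_le_of_mem_root_region₂ P du (key hd) i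
  have h2 := abs_apply_le_of_mem_root_region₂ P du (key hd') i
  rw [abs_le] at h1 h2
  simp only [Pi.sub_apply]
  constructor <;> linarith [h1.1, h1.2, h2.1, h2.2]

/-! ## §2 The rim excess of the root band run -/

/-- **THE RIM EXCESS OF THE ROOT BAND RUN**: under the cut root law, `P(⋃_{z ∈ Rim_k} w₀ ↔ z) ≤ η` for every step `k ≤ N`, given an excess
radius `R₁ ≤ Rt − L'` at the running parameter for entrances at depth `E₀ + 1` (the wired root cube has depth `rQ 0 0 ≤ E₀`) and habitats of
planar diameter `m ≥ 60 rmax` (the shape of `Skelφ.exists_excess_radius_uniform` at the centre `w₀`). [cite: KozmaNitzan2024, §4 Lemma 12 (p. 24), p. 28] -/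
theorem real_rim_le_rootSG [Countable V] (hlip : Lip G φ) (hstep : Steps G φ) (hΛ : WFS2 P Λ) (hφ : φ w₀ = 0)
    (h : RootBandOK P du s₁ R' ℓ₀ N WM Wb ca cb q' ρ) (hRB : Rt + 1 ≤ Λ.rB 0 0 du) (hRQ : Rt + 1 ≤ Λ.rQ 0 ((0 : Site 2) + stepVec du))
    {E₀ : ℕ} (hQ0 : Λ.rQ 0 0 ≤ E₀) {m : ℕ} (hm : 60 * P.rmax ≤ m) {η : ℝ} {R₁ : ℕ}
    (hR₁ : ∀ R'', R₁ ≤ R'' → ∀ (Rw : ℕ) (D' A' : Finset V), (∀ d ∈ D', d ∈ graphBall G w₀ Rw) →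
      (∀ d ∈ D', ∀ d' ∈ D', φ d - φ d' ∈ box 2 m) → A' ⊆ D' → (∀ a ∈ A', a ∈ graphBall G w₀ (E₀ + 1)) →
        (bondPercolation G q).real (excess G w₀ R'' D' A') ≤ η)
    {L' : ℕ} (hR : R₁ ≤ Rt - L') {Rlev Nc j₀ j₁ : ℕ} {k : ℕ} (hk : k ≤ N) :
    (prodBernoulli ((⟨cellGeomSG G φ P w₀ Λ, q, δc⟩ : KSchA V ℕ).W0sub G (rootUS G φ P w₀ Λ q δc Rt du))).real
      (⋃ z ∈ (rootWCD G φ w₀ Rt L' (rootSched P du h) Rlev Nc j₀ j₁ (rootUS G φ P w₀ Λ q δc Rt du)).Rim k, openConn w₀ z) ≤ η := by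
  set S : KSchA V ℕ := ⟨cellGeomSG G φ P w₀ Λ, q, δc⟩ with hSdef
  set U' := rootUS G φ P w₀ Λ q δc Rt du with hU'
  set Pc := rootWCD G φ w₀ Rt L' (rootSched P du h) Rlev Nc j₀ j₁ U' with hPc
  set D : Finset V := U' \ S.Γ.Q S.Γ.a₀ 0 with hD
  -- the fresh root world is a subbox of the window graph
  have hWD : IsSubbox (winGraph G w₀ Rt) (S.W0sub G U') q D :=
    isSubbox_W0sub_win G w₀ Rt (S := S) (U := S.U0root du) Finset.sdiff_subset Finset.sdiff_disjoint
  have hDπ : ∀ v ∈ D, v ∈ graphBall G w₀ Rt := fun v hv => (Finset.mem_filter.1 (Finset.mem_sdiff.1 hv).1).2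
  have hWG : ∀ e, e ∉ G.edgeSet → S.W0sub G U' e = 0 := fun e he => W0sub_eq_zero_of_not_mem_edgeSet S U' he
  have hrootQ : w₀ ∈ S.Γ.Q S.Γ.a₀ 0 := (sepGeomSG P w₀ hΛ hφ hstep).root_mem
  have hroot : w₀ ∉ D := fun h' => (Finset.mem_sdiff.1 h').2 hrootQ
  have hRimD : Pc.Rim k ⊆ D := by
    intro z hz
    have hz' : z ∈ (planarWindowWin hlip w₀ Rt).stepD (rootSched P du h) k :=
      rootWCD_Rim_subset hlip w₀ Rt L' (rootSched P du h) Rlev Nc j₀ j₁ U' k hz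
    exact Finset.mem_sdiff.2 ⟨rootSched_stepD_subset_rootUS hlip hstep h hRB hRQ hk hz',
      Finset.disjoint_left.1 (rootSched_stepD_disjoint_Q hlip (Λ := Λ) (q := q) (δc := δc) h hk) hz'⟩
  have hRimfar : ∀ z ∈ Pc.Rim k, z ∉ graphBall G w₀ (Rt - L') := fun z hz => not_mem_graphBall_of_mem_rootWCD_Rim hz
  -- entrances come from the wired root cube (depth `≤ rQ 0 0 ≤ E₀`)
  have hA : ∀ a b, a ∉ D → b ∈ D → G.Adj a b → S.W0sub G U' s(a, b) ≠ 0 → b ∈ graphBall G w₀ (E₀ + 1) := by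
    intro a b ha hb hadj hw
    have haU : a ∈ U' := by
      by_contra haU
      apply hw
      unfold KSchA.W0sub
      exact restrW_apply_of_not_mem _ (fun h' => haU (Finset.mem_coe.1 (h'.1 a (Sym2.mem_mk_left _ _))))
    have haQ : a ∈ S.Γ.Q S.Γ.a₀ 0 := by
      by_contra haQ
      exact ha (Finset.mem_sdiff.2 ⟨haU, haQ⟩)
    have ha1 : a ∈ graphBall G w₀ E₀ := by
      change a ∈ VWin G φ w₀ (P.Q 0) (Λ.rQ 0 0) at haQ
      exact graphBall_mono G w₀ hQ0 (mem_graphBall_of_mem_VWin haQ)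
    exact BoxProdZ2.mem_graphBall_succ_of_adj G ha1 hadj
  refine real_rim_le_of_radius (Wt := S.W0sub G U') (q := q) (D := D) (root := w₀) (w₀ := w₀) (R := Rt) (L' := L') (R₀' := E₀ + 1)
    (Rim := Pc.Rim k) (m := m) (η := η) (R₁ := R₁) (by convert hWD) hDπ hWG hroot hRimD hRimfar hA ?_ hR (Rw := Rt) hDπ
    (fun d hd d' hd' => φ_sub_φ_mem_box_of_mem_rootUS hm hd hd')
  intro R'' hR'' Rw D' A' h1 h2 h3 h4
  convert hR₁ R'' hR'' Rw D' A' h1 h2 h3 h4 using 3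

end Root

end Skelφ

end Transplant

end Summit.CriticalPhenomena.PercolationContinuityZ3.Theorems

end
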